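import Literature.NumberTheory.Automorphic.Sweep1PotentialModularitySolubleDescent
import Literature.NumberTheory.EllipticCurves.HasseWeilGoodReduction
import Literature.NumberTheory.EllipticCurves.HasseWeilGoodReductionProofs
import Literature.NumberTheory.EllipticCurves.GoodReductionUnramifiedProofs
import Literature.NumberTheory.EllipticCurves.TateModuleFinite
import Literature.NumberTheory.NumberFields.TotallyRealOrCM
import HarnessLib

/-!
# Potential modularity with soluble descent (lang.S28, strong form): the Galois half of the
# compatible system `R_E`, and the CM intermediate fields — proofs

Pure-proof sibling (theorems only: no definition, no named fact) of
`Literature.NumberTheory.Automorphic.Sweep1PotentialModularitySolubleDescent`, whose named fact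
`exists_isCMField_forall_isSolvable_isTateAutomorphic` transcribes Allen–Calegari–Caraiani–Gee–
Helm–Le Hung–Newton–Scholze–Taylor–Thorne, *Potential automorphy over CM fields*, Ann. of Math.
197 (2023), Cor. 7.1.12 (`m = 1`, `R = R_E`) with the soluble descent of their Prop. 6.5.13 (2).
The printed proof has three inputs (module docstring of the parent, "The strong form"):

1. `R_E = (ℚ, S_E, {X² - a_v X + q_v}, {V_l(E)^∨}, {{0,1}})` **is** a very weakly compatible
   system — in particular condition (5a) of §7.1: *if `v ∉ S` and `v ∤ l` then `r_λ` is
   unramified at `v` and `r_λ(Frob_v)` has characteristic polynomial `Q_v(X)`*;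
2. Cor. 7.1.12 itself (automorphy of `R_E|_{G_{F'}}` over a finite Galois CM `F'/F`) — the whole
   of the source, the tree's apex debt `exists_isCMField_isTateAutomorphic`;
3. Prop. 6.5.13 (2) over every intermediate field `F ⊆ K ⊆ F'` with `Gal(F'/K)` soluble, whose
   hypotheses ask `K` to be (imaginary) CM.

This file **proves input 1 and the field theory of input 3** on the tree's objects, and records
the resulting reduction of the named fact to its purely automorphic content:

* `WeierstrassCurve.hasTateFrobPolyAt_frobeniusTraceAt_of_hasGoodReductionAt` (**proved**): at a
  place `v` of good reduction of an elliptic curve `E/K` over a number field, `V_ℓ E` is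
  unramified with arithmetic Frobenius polynomial `X² - a_v X + q_v` for *every* prime `ℓ` with
  `v ∤ ℓ`, `a_v = q_v + 1 - #Ẽ_v(k_v)` (`WeierstrassCurve.frobeniusTraceAt`, one integer for all
  `ℓ`) — condition (5a) for `R_E` at `v ∉ S_E`, i.e. the parent's `HasTateFrobPolyAt W v a_v`.
  Inputs, all theorems of the tree: Silverman, *AEC*, Prop. VII.4.1(b)
  (`isUnramifiedAt_rationalTateGaloisRepOf_geomPoints`, `GoodReductionUnramifiedProofs`) and C.21
  Remark 21.3 (`hasFrobCharpolyAt_rationalTateGaloisRepOf_of_hasGoodReductionAt` with the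
  discharged `trace/det_galoisRepTate_frobenius_of_hasGoodReductionAt_holds`,
  `HasseWeilGoodReductionProofs`: Thm. V.2.3.1 and the Weil pairing).
* `WeierstrassCurve.eventually_hasTateFrobPolyAt_frobeniusTraceAt`,
  `WeierstrassCurve.eventually_exists_hasTateFrobPolyAt` (**proved**): hence at all but finitely
  many `v` (Silverman Rem. VIII.1.3, `eventually_hasGoodReductionAt`) — the Galois conjunct of
  both `IsTateAutomorphic` and `IsCuspidalTateAutomorphic`, unconditionally.
* `WeierstrassCurve.HasTateFrobPolyAt.unique`, `.eq_frobeniusTraceAt` (**proved**): the integer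
  `a` of `HasTateFrobPolyAt W v a` is unique (some prime `ℓ` has `v ∤ ℓ`; continuity and
  finite-dimensionality of `V_ℓ E` are theorems of the tree; a Frobenius at `v` exists), hence
  equals `a_v(E)` at the places of good reduction.
* `WeierstrassCurve.isTateAutomorphic_of_satake`, `WeierstrassCurve.isCuspidalTateAutomorphic_of_satake`,
  `exists_isCMField_forall_isSolvable_isTateAutomorphic_of_satake`, the converses
  `IsTateAutomorphic.exists_satake`, `IsCuspidalTateAutomorphic.exists_satake`, and
  `exists_isCMField_forall_isSolvable_isTateAutomorphic_iff_satake` (**proved**): the named fact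
  is *equivalent* to its automorphic half alone — the existence, over each soluble-index
  intermediate field `K`, of the cuspidal automorphic representations of `GL₂(𝔸_K)` whose Satake
  parameters at almost all `v` have the polynomial `X² - a_v(E_K) X + q_v` (inputs 2 and 3:
  Cor. 7.1.12 and Prop. 6.5.13 (2), which remain the debt; no Galois-side debt is left).
* `ringEquiv_apply_complexConj`, `exists_algebraMap_eq_complexConj_algebraMap`,
  `isCMField_of_isGalois_isCMField`, `isCMField_of_isScalarTower` (**proved**): every intermediate
  field of a Galois extension `F'/F` of CM fields is CM (the Galois case of Shimura, *Abelian
  Varieties with Complex Multiplication and Modular Functions* (1998), §18.2, Lemma 18.2 (iv): *"A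
  subfield of a CM-field is either totally real or a CM-field"*), so that Prop. 6.5.13 (2) applies
  to the fields `K` of the strong form.

## References

* P. B. Allen et al., *Potential automorphy over CM fields*, Ann. of Math. (2) 197 (2023),
  897–1113: §7.1 (condition (5a); "automorphic"), Cor. 7.1.12, Prop. 6.5.13 (2).
  [AllenCalegariCaraianiGeeEtAl2023]
* J. H. Silverman, *The Arithmetic of Elliptic Curves*, 2nd ed., GTM 106 (2009): Thm. V.2.3.1,
  Prop. VII.4.1, Rem. VIII.1.3, C.§16, C.21 Remark 21.3. [SilvermanAEC2009]
* J.-P. Serre, *Abelian ℓ-adic representations and elliptic curves* (1968), Ch. I §2.3.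
  [SerreAbelianLadic1968]
* G. Shimura, *Abelian Varieties with Complex Multiplication and Modular Functions*, Princeton
  (1998): §18.1 (definition of a CM-field), §18.2, Lemma 18.2 and the remark following its proof.
  [Shimura1998]
-/

noncomputable section

open scoped MatrixGroups Polynomial NumberField
open NumberField IsDedekindDomain MeasureTheory Filter Polynomial

namespace Literature.NumberTheory.Automorphic

/-! ### Input 1: condition (5a) for `R_E` — the Galois half, proved -/

section GaloisHalf

variable {K : Type} [Field K] [NumberField K]

/-- `(X² - a X + q).map (ℤ → R) = X² - a X + q` with the casts pushed inside. [folklore] -/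
theorem map_frobPoly_eq (R : Type*) [CommRing R] (a : ℤ) (q : ℕ) :
    (frobPoly a q).map (Int.castRingHom R) = X ^ 2 - C (a : R) * X + C (q : R) := by
  simp [frobPoly, Polynomial.map_sub, Polynomial.map_add, Polynomial.map_mul, Polynomial.map_pow]

/-- **Condition (5a) for `R_E` at a place of good reduction** (source §7.1, for the compatible
system of an elliptic curve): if `E/K` has good reduction at `v`, then for every prime `ℓ` with
`v ∤ ℓ` (and all continuity / finiteness witnesses of `V_ℓ E`) the rational Tate module `V_ℓ E` is
unramified at `v` and every arithmetic Frobenius at `v` has characteristic polynomial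
`X² - a_v X + q_v`, where `a_v = q_v + 1 - #Ẽ_v(k_v)` (`W.frobeniusTraceAt v`) is one integer for
all `ℓ` — i.e. `W.HasTateFrobPolyAt v (W.frobeniusTraceAt v)`. Silverman, *AEC*, Prop. VII.4.1(b)
(unramified: the tree's `isUnramifiedAt_rationalTateGaloisRepOf_geomPoints`) and C.21 Remark 21.3
(*"Trace ρ(φ_v) = a_v and Norm ρ(φ_v) = q_v"*: the tree's
`hasFrobCharpolyAt_rationalTateGaloisRepOf_of_hasGoodReductionAt` with the discharged
`trace_/det_galoisRepTate_frobenius_of_hasGoodReductionAt_holds`), and `#k_v = q_v`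
(`natCard_residueField_eq_residueCard`).
[cite: SilvermanAEC2009, Prop. VII.4.1(b) and C.21 Remark 21.3]
[cite: AllenCalegariCaraianiGeeEtAl2023, §7.1 (condition (5a), for R = R_E)] -/
theorem _root_.WeierstrassCurve.hasTateFrobPolyAt_frobeniusTraceAt_of_hasGoodReductionAt
    (W : WeierstrassCurve K) [W.IsElliptic] {v : HeightOneSpectrum (𝓞 K)}
    (hv : W.HasGoodReductionAt v) : W.HasTateFrobPolyAt v (W.frobeniusTraceAt v) := by
  intro ℓ _ hℓ h hfin
  refine ⟨W.isUnramifiedAt_rationalTateGaloisRepOf_geomPoints ℓ h hv hℓ, ?_⟩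
  haveI : Module.Finite ℚ_[ℓ] (W.rationalTateModule ℓ) := hfin
  have key := WeierstrassCurve.hasFrobCharpolyAt_rationalTateGaloisRepOf_of_hasGoodReductionAt
    (W.trace_galoisRepTate_frobenius_of_hasGoodReductionAt_holds ℓ)
    (W.det_galoisRepTate_frobenius_of_hasGoodReductionAt_holds ℓ) h hℓ hv
  rw [map_frobPoly_eq, ← WeierstrassCurve.natCard_residueField_eq_residueCard]
  exact key

/-- **Condition (5a) for `R_E` at all but finitely many places**: an elliptic curve over a number
field has good reduction at all but finitely many `v` (Silverman, *AEC*, Rem. VIII.1.3; the tree's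
`eventually_hasGoodReductionAt`), where `hasTateFrobPolyAt_frobeniusTraceAt_of_hasGoodReductionAt`
applies. [cite: SilvermanAEC2009, Rem. VIII.1.3, Prop. VII.4.1(b), C.21 Remark 21.3] -/
theorem _root_.WeierstrassCurve.eventually_hasTateFrobPolyAt_frobeniusTraceAt
    (W : WeierstrassCurve K) [W.IsElliptic] :
    ∀ᶠ v : HeightOneSpectrum (𝓞 K) in cofinite, W.HasTateFrobPolyAt v (W.frobeniusTraceAt v) := by
  filter_upwards [W.eventually_hasGoodReductionAt] with v hv
  exact W.hasTateFrobPolyAt_frobeniusTraceAt_of_hasGoodReductionAt hv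

/-- The Galois conjunct of `IsTateAutomorphic` / `IsCuspidalTateAutomorphic`, unconditionally: at
all but finitely many `v` there is an integer `a` with `W.HasTateFrobPolyAt v a`.
[cite: SilvermanAEC2009, Rem. VIII.1.3, Prop. VII.4.1(b), C.21 Remark 21.3] -/
theorem _root_.WeierstrassCurve.eventually_exists_hasTateFrobPolyAt
    (W : WeierstrassCurve K) [W.IsElliptic] :
    ∀ᶠ v : HeightOneSpectrum (𝓞 K) in cofinite, ∃ a : ℤ, W.HasTateFrobPolyAt v a := by
  filter_upwards [W.eventually_hasTateFrobPolyAt_frobeniusTraceAt] with v hv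
  exact ⟨_, hv⟩

omit [NumberField K] in
/-- Every finite place of a number field misses some rational prime (`2 ∉ v` or `3 ∉ v`, as
`3 - 2 = 1 ∉ v`). [folklore] -/
theorem exists_prime_natCast_not_mem_asIdeal (v : HeightOneSpectrum (𝓞 K)) :
    ∃ ℓ : ℕ, ℓ.Prime ∧ (ℓ : 𝓞 K) ∉ v.asIdeal := by
  by_contra h
  push Not at h
  have h2 := h 2 Nat.prime_two
  have h3 := h 3 Nat.prime_three
  apply v.isPrime.ne_top
  rw [Ideal.eq_top_iff_one]
  have e : ((3 : ℕ) : 𝓞 K) - ((2 : ℕ) : 𝓞 K) = 1 := by norm_num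
  rw [← e]
  exact Ideal.sub_mem _ h3 h2

/-- **The integer `a` in `HasTateFrobPolyAt W v a` is unique** (for an elliptic curve): take a
prime `ℓ` with `v ∤ ℓ` (`exists_prime_natCast_not_mem_asIdeal`), the tree's continuity and
finiteness theorems for `V_ℓ E` (`continuous_rationalGaloisRepTate_holds`,
`module_finite_rationalTateModule_holds`), a prime `𝔓 ∣ v` of `\bar ℤ_K` and an arithmetic
Frobenius at it (`primesAbove_nonempty`, `exists_isArithFrobAt_of_mem_primesAbove_holds`): both
`X² - a X + q_v` and `X² - b X + q_v` are its characteristic polynomial on `V_ℓ E`.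
[cite: SerreAbelianLadic1968, Ch. I §2.3 (the polynomials P_{v,ρ} of a rational representation)] -/
theorem _root_.WeierstrassCurve.HasTateFrobPolyAt.unique {W : WeierstrassCurve K} [W.IsElliptic]
    {v : HeightOneSpectrum (𝓞 K)} {a b : ℤ} (ha : W.HasTateFrobPolyAt v a)
    (hb : W.HasTateFrobPolyAt v b) : a = b := by
  obtain ⟨ℓ, hℓp, hℓ⟩ := exists_prime_natCast_not_mem_asIdeal v
  haveI : Fact ℓ.Prime := ⟨hℓp⟩
  haveI hfinI : Module.Finite ℚ_[ℓ] (W.rationalTateModule ℓ) :=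
    W.module_finite_rationalTateModule_holds ℓ
  have hc : Continuous fun x : Field.absoluteGaloisGroup K × W.rationalTateModule ℓ =>
      EllipticCurves.rationalTateRepresentation (Field.absoluteGaloisGroup K)
        (WeierstrassCurve.geomPoints W) ℓ x.1 x.2 :=
    W.continuous_rationalGaloisRepTate_holds ℓ
  obtain ⟨-, hA⟩ := ha ℓ hℓ hc hfinI
  obtain ⟨-, hB⟩ := hb ℓ hℓ hc hfinI
  obtain ⟨𝔓, h𝔓⟩ := HeightOneSpectrum.primesAbove_nonempty v
  obtain ⟨σ, hσ⟩ := HeightOneSpectrum.exists_isArithFrobAt_of_mem_primesAbove_holds h𝔓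
  have hPQ : frobPoly a v.residueCard = frobPoly b v.residueCard :=
    Polynomial.map_injective (Int.castRingHom ℚ_[ℓ]) (RingHom.injective_int _)
      ((hA 𝔓 h𝔓 σ hσ).symm.trans (hB 𝔓 h𝔓 σ hσ))
  have h1 := congrArg (fun P : ℤ[X] => P.coeff 1) hPQ
  simpa using h1

/-- At a place of good reduction the integer of `HasTateFrobPolyAt` **is** `a_v(E)`
(`hasTateFrobPolyAt_frobeniusTraceAt_of_hasGoodReductionAt` and uniqueness).
[cite: SilvermanAEC2009, C.21 Remark 21.3] -/
theorem _root_.WeierstrassCurve.HasTateFrobPolyAt.eq_frobeniusTraceAt {W : WeierstrassCurve K}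
    [W.IsElliptic] {v : HeightOneSpectrum (𝓞 K)} {a : ℤ} (ha : W.HasTateFrobPolyAt v a)
    (hv : W.HasGoodReductionAt v) : a = W.frobeniusTraceAt v :=
  ha.unique (W.hasTateFrobPolyAt_frobeniusTraceAt_of_hasGoodReductionAt hv)

end GaloisHalf

/-! ### The named fact from its automorphic half -/

section Reduction

variable {K : Type} [Field K] [NumberField K]

/-- **`IsTateAutomorphic` from its automorphic half.** If some cuspidal `Π ≤ L²_cusp(GL₂)` of
level `𝔫` has, at all but finitely many `v ∤ 𝔫`, a Satake parameter `α` with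
`∏ (X - q_v^{1/2} α_j) = X² - a_v(E) X + q_v` (`a_v(E) = W.frobeniusTraceAt v`), then `E` is
Tate-automorphic: the Galois conjunct is `eventually_hasTateFrobPolyAt_frobeniusTraceAt`.
[cite: AllenCalegariCaraianiGeeEtAl2023, §7.1 (definition of "automorphic", for R = R_E)] -/
theorem _root_.WeierstrassCurve.isTateAutomorphic_of_satake (W : WeierstrassCurve K) [W.IsElliptic]
    (h : ∃ (μ : Measure (AdelicGroupData.gl 2 K).automorphicQuotient)
        (_ : (AdelicGroupData.gl 2 K).IsAutomorphicMeasure μ) (P : CuspidalAutomorphicRepGL 2 K μ)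
        (𝔫 : Ideal (𝓞 K)) (_ : 𝔫 ≠ 0),
        ∀ᶠ v : HeightOneSpectrum (𝓞 K) in cofinite,
          ¬ v.asIdeal ∣ 𝔫 ∧ ∃ (ϖ : (v.adicCompletion K)ˣ) (α : Multiset ℂ),
            HasSatakeParameterAt P.1 (principalCongruenceLevel 2 K 𝔫) v ϖ α ∧
            (α.map fun z => (X : ℂ[X]) -
                Polynomial.C (((Real.sqrt (v.residueCard : ℝ) : ℝ) : ℂ) * z)).prod =
              (frobPoly (W.frobeniusTraceAt v) v.residueCard).map (Int.castRingHom ℂ)) :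
    W.IsTateAutomorphic := by
  obtain ⟨μ, hμ, P, 𝔫, h𝔫, hev⟩ := h
  refine ⟨μ, hμ, P, 𝔫, h𝔫, ?_⟩
  filter_upwards [hev, W.eventually_hasTateFrobPolyAt_frobeniusTraceAt] with v hv hG
  obtain ⟨hn, ϖ, α, hS, hpoly⟩ := hv
  exact ⟨hn, ϖ, α, W.frobeniusTraceAt v, hS, hpoly, hG⟩

/-- **`IsCuspidalTateAutomorphic` from its automorphic half.** If there are cuspidal automorphic
representations `π` (weight zero), `π_H`, `π_V` (L-algebraic) of `GL₂(𝔸_K)` whose Satake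
parameters at all but finitely many `v` satisfy the three identities of
`IsCuspidalTateAutomorphic` with `a = a_v(E) = W.frobeniusTraceAt v`, then `E` is
cuspidal-Tate-automorphic: the Galois conjunct is `eventually_hasTateFrobPolyAt_frobeniusTraceAt`.
[cite: AllenCalegariCaraianiGeeEtAl2023, §7.1 (definition of "automorphic", for R = R_E)] -/
theorem _root_.WeierstrassCurve.isCuspidalTateAutomorphic_of_satake (W : WeierstrassCurve K)
    [W.IsElliptic]
    (h : ∃ (hK : isCompact_glFiniteIntegralLevel 2 K) (π πH πV : CuspidalAutomorphicRepData 2 K hK),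
        π.1.HasWeightZero ∧ πH.1.IsLAlgebraic ∧ πV.1.IsLAlgebraic ∧
        ∀ᶠ v : HeightOneSpectrum (𝓞 K) in cofinite, ∃ (α β γ : Multiset ℂ),
          (π.1.HasSatakeParamAt v α ∧
            (α.map fun z => (X : ℂ[X]) -
                Polynomial.C (((Real.sqrt (v.residueCard : ℝ) : ℝ) : ℂ) * z)).prod =
              (frobPoly (W.frobeniusTraceAt v) v.residueCard).map (Int.castRingHom ℂ)) ∧
          (πH.1.HasSatakeParamAt v β ∧
            (β.map fun z => (X : ℂ[X]) - Polynomial.C z).prod =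
              (frobPoly (W.frobeniusTraceAt v) v.residueCard).map (Int.castRingHom ℂ)) ∧
          (πV.1.HasSatakeParamAt v γ ∧
            (γ.map fun z => (X : ℂ[X]) - Polynomial.C z⁻¹).prod =
              (frobPoly (W.frobeniusTraceAt v) v.residueCard).map (Int.castRingHom ℂ))) :
    W.IsCuspidalTateAutomorphic := by
  obtain ⟨hK, π, πH, πV, h0, hH, hV, hev⟩ := h
  refine ⟨hK, π, πH, πV, h0, hH, hV, ?_⟩
  filter_upwards [hev, W.eventually_hasTateFrobPolyAt_frobeniusTraceAt] with v hv hG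
  obtain ⟨α, β, γ, hα, hβ, hγ⟩ := hv
  exact ⟨W.frobeniusTraceAt v, α, β, γ, hG, hα, hβ, hγ⟩

/-- **The strong form from its automorphic half** (Cor. 7.1.12 for `R_E` with the soluble descent
of Prop. 6.5.13 (2), read purely on the automorphic side). If for every elliptic curve `E` without
geometric CM over a CM field `F` there is a finite Galois CM `F'/F` such that over every
intermediate `K` with `Gal(F'/K)` soluble there are the cuspidal automorphic representations of
`GL₂(𝔸_K)` of `isTateAutomorphic_of_satake` and `isCuspidalTateAutomorphic_of_satake` (Satake
parameters with polynomial `X² - a_v(E_K) X + q_v` at almost all `v`), then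
`exists_isCMField_forall_isSolvable_isTateAutomorphic` holds: the Galois half (condition (5a) for
`R_{E_K}`) is `eventually_hasTateFrobPolyAt_frobeniusTraceAt`. What remains (the hypothesis) is
exactly the automorphic existence statement of Cor. 7.1.12 (`m = 1`, `R = R_E`) combined with
Prop. 6.5.13 (2).
[cite: AllenCalegariCaraianiGeeEtAl2023, Cor. 7.1.12 (m = 1, R = R_E) and Prop. 6.5.13 (2), with §7.1] -/
theorem exists_isCMField_forall_isSolvable_isTateAutomorphic_of_satake
    (h : ∀ {F : Type} [Field F] [NumberField F] [IsCMField F] (W : WeierstrassCurve F)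
      [W.IsElliptic] (_hW : ¬ W.HasCM),
      ∃ (F' : Type) (_ : Field F') (_ : NumberField F') (_ : Algebra F F'),
        IsCMField F' ∧ IsGalois F F' ∧
        ∀ (K : Type) [Field K] [NumberField K] [Algebra F K] [Algebra K F'] [IsScalarTower F K F'],
          IsSolvable (F' ≃ₐ[K] F') →
            (∃ (μ : Measure (AdelicGroupData.gl 2 K).automorphicQuotient)
                (_ : (AdelicGroupData.gl 2 K).IsAutomorphicMeasure μ)
                (P : CuspidalAutomorphicRepGL 2 K μ) (𝔫 : Ideal (𝓞 K)) (_ : 𝔫 ≠ 0),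
                ∀ᶠ v : HeightOneSpectrum (𝓞 K) in cofinite,
                  ¬ v.asIdeal ∣ 𝔫 ∧ ∃ (ϖ : (v.adicCompletion K)ˣ) (α : Multiset ℂ),
                    HasSatakeParameterAt P.1 (principalCongruenceLevel 2 K 𝔫) v ϖ α ∧
                    (α.map fun z => (X : ℂ[X]) -
                        Polynomial.C (((Real.sqrt (v.residueCard : ℝ) : ℝ) : ℂ) * z)).prod =
                      (frobPoly ((W.baseChange K).frobeniusTraceAt v) v.residueCard).map
                        (Int.castRingHom ℂ)) ∧
            (∃ (hK : isCompact_glFiniteIntegralLevel 2 K)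
                (π πH πV : CuspidalAutomorphicRepData 2 K hK),
                π.1.HasWeightZero ∧ πH.1.IsLAlgebraic ∧ πV.1.IsLAlgebraic ∧
                ∀ᶠ v : HeightOneSpectrum (𝓞 K) in cofinite, ∃ (α β γ : Multiset ℂ),
                  (π.1.HasSatakeParamAt v α ∧
                    (α.map fun z => (X : ℂ[X]) -
                        Polynomial.C (((Real.sqrt (v.residueCard : ℝ) : ℝ) : ℂ) * z)).prod =
                      (frobPoly ((W.baseChange K).frobeniusTraceAt v) v.residueCard).map
                        (Int.castRingHom ℂ)) ∧
                  (πH.1.HasSatakeParamAt v β ∧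
                    (β.map fun z => (X : ℂ[X]) - Polynomial.C z).prod =
                      (frobPoly ((W.baseChange K).frobeniusTraceAt v) v.residueCard).map
                        (Int.castRingHom ℂ)) ∧
                  (πV.1.HasSatakeParamAt v γ ∧
                    (γ.map fun z => (X : ℂ[X]) - Polynomial.C z⁻¹).prod =
                      (frobPoly ((W.baseChange K).frobeniusTraceAt v) v.residueCard).map
                        (Int.castRingHom ℂ)))) :
    exists_isCMField_forall_isSolvable_isTateAutomorphic := by
  intro F _ _ _ W _ hW
  obtain ⟨F', hF', hNF', hAlg, hCM, hGal, hsol⟩ := h W hW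
  refine ⟨F', hF', hNF', hAlg, hCM, hGal, fun K _ _ _ _ _ hs => ?_⟩
  obtain ⟨hL2, hcusp⟩ := hsol K hs
  haveI : (W.baseChange K).IsElliptic := by
    dsimp only [WeierstrassCurve.baseChange]
    infer_instance
  exact ⟨(W.baseChange K).isTateAutomorphic_of_satake hL2,
    (W.baseChange K).isCuspidalTateAutomorphic_of_satake hcusp⟩

/-- **The automorphic half of `IsTateAutomorphic`, with `a = a_v(E)`.** Conversely, a
Tate-automorphic elliptic curve has the cuspidal `Π` of `isTateAutomorphic_of_satake`: at the
places of good reduction (all but finitely many) the integer `a` of the definition is `a_v(E)`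
(`HasTateFrobPolyAt.eq_frobeniusTraceAt`).
[cite: AllenCalegariCaraianiGeeEtAl2023, §7.1 (definition of "automorphic", for R = R_E)] -/
theorem _root_.WeierstrassCurve.IsTateAutomorphic.exists_satake {W : WeierstrassCurve K}
    [W.IsElliptic] (hW : W.IsTateAutomorphic) :
    ∃ (μ : Measure (AdelicGroupData.gl 2 K).automorphicQuotient)
        (_ : (AdelicGroupData.gl 2 K).IsAutomorphicMeasure μ) (P : CuspidalAutomorphicRepGL 2 K μ)
        (𝔫 : Ideal (𝓞 K)) (_ : 𝔫 ≠ 0),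
        ∀ᶠ v : HeightOneSpectrum (𝓞 K) in cofinite,
          ¬ v.asIdeal ∣ 𝔫 ∧ ∃ (ϖ : (v.adicCompletion K)ˣ) (α : Multiset ℂ),
            HasSatakeParameterAt P.1 (principalCongruenceLevel 2 K 𝔫) v ϖ α ∧
            (α.map fun z => (X : ℂ[X]) -
                Polynomial.C (((Real.sqrt (v.residueCard : ℝ) : ℝ) : ℂ) * z)).prod =
              (frobPoly (W.frobeniusTraceAt v) v.residueCard).map (Int.castRingHom ℂ) := by
  obtain ⟨μ, hμ, P, 𝔫, h𝔫, hev⟩ := hW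
  refine ⟨μ, hμ, P, 𝔫, h𝔫, ?_⟩
  filter_upwards [hev, W.eventually_hasGoodReductionAt] with v hv hgood
  obtain ⟨hn, ϖ, α, a, hS, hpoly, hG⟩ := hv
  have hG' : W.HasTateFrobPolyAt v a := hG
  obtain rfl : a = W.frobeniusTraceAt v := hG'.eq_frobeniusTraceAt hgood
  exact ⟨hn, ϖ, α, hS, hpoly⟩

/-- **The automorphic half of `IsCuspidalTateAutomorphic`, with `a = a_v(E)`**: conversely to
`isCuspidalTateAutomorphic_of_satake` (`HasTateFrobPolyAt.eq_frobeniusTraceAt` at the places of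
good reduction). [cite: AllenCalegariCaraianiGeeEtAl2023, §7.1 (definition of "automorphic", for R = R_E)] -/
theorem _root_.WeierstrassCurve.IsCuspidalTateAutomorphic.exists_satake {W : WeierstrassCurve K}
    [W.IsElliptic] (hW : W.IsCuspidalTateAutomorphic) :
    ∃ (hK : isCompact_glFiniteIntegralLevel 2 K) (π πH πV : CuspidalAutomorphicRepData 2 K hK),
        π.1.HasWeightZero ∧ πH.1.IsLAlgebraic ∧ πV.1.IsLAlgebraic ∧
        ∀ᶠ v : HeightOneSpectrum (𝓞 K) in cofinite, ∃ (α β γ : Multiset ℂ),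
          (π.1.HasSatakeParamAt v α ∧
            (α.map fun z => (X : ℂ[X]) -
                Polynomial.C (((Real.sqrt (v.residueCard : ℝ) : ℝ) : ℂ) * z)).prod =
              (frobPoly (W.frobeniusTraceAt v) v.residueCard).map (Int.castRingHom ℂ)) ∧
          (πH.1.HasSatakeParamAt v β ∧
            (β.map fun z => (X : ℂ[X]) - Polynomial.C z).prod =
              (frobPoly (W.frobeniusTraceAt v) v.residueCard).map (Int.castRingHom ℂ)) ∧
          (πV.1.HasSatakeParamAt v γ ∧
            (γ.map fun z => (X : ℂ[X]) - Polynomial.C z⁻¹).prod =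
              (frobPoly (W.frobeniusTraceAt v) v.residueCard).map (Int.castRingHom ℂ)) := by
  obtain ⟨hK, π, πH, πV, h0, hH, hV, hev⟩ := hW
  refine ⟨hK, π, πH, πV, h0, hH, hV, ?_⟩
  filter_upwards [hev, W.eventually_hasGoodReductionAt] with v hv hgood
  obtain ⟨a, α, β, γ, hG, hα, hβ, hγ⟩ := hv
  obtain rfl : a = W.frobeniusTraceAt v := hG.eq_frobeniusTraceAt hgood
  exact ⟨α, β, γ, hα, hβ, hγ⟩

/-- **The strong form is equivalent to its automorphic half** (`_of_satake` and the converses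
`IsTateAutomorphic.exists_satake`, `IsCuspidalTateAutomorphic.exists_satake`): the Galois side of
the named fact carries no debt, and what Cor. 7.1.12 with Prop. 6.5.13 (2) must supply is exactly
the cuspidal automorphic representations of `GL₂` over the soluble-index intermediate fields with
Satake polynomials `X² - a_v(E_K) X + q_v` at almost all places.
[cite: AllenCalegariCaraianiGeeEtAl2023, Cor. 7.1.12 (m = 1, R = R_E) and Prop. 6.5.13 (2), with §7.1] -/
theorem exists_isCMField_forall_isSolvable_isTateAutomorphic_iff_satake :
    exists_isCMField_forall_isSolvable_isTateAutomorphic ↔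
    ∀ {F : Type} [Field F] [NumberField F] [IsCMField F] (W : WeierstrassCurve F)
      [W.IsElliptic] (_hW : ¬ W.HasCM),
      ∃ (F' : Type) (_ : Field F') (_ : NumberField F') (_ : Algebra F F'),
        IsCMField F' ∧ IsGalois F F' ∧
        ∀ (K : Type) [Field K] [NumberField K] [Algebra F K] [Algebra K F'] [IsScalarTower F K F'],
          IsSolvable (F' ≃ₐ[K] F') →
            (∃ (μ : Measure (AdelicGroupData.gl 2 K).automorphicQuotient)
                (_ : (AdelicGroupData.gl 2 K).IsAutomorphicMeasure μ)
                (P : CuspidalAutomorphicRepGL 2 K μ) (𝔫 : Ideal (𝓞 K)) (_ : 𝔫 ≠ 0),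
                ∀ᶠ v : HeightOneSpectrum (𝓞 K) in cofinite,
                  ¬ v.asIdeal ∣ 𝔫 ∧ ∃ (ϖ : (v.adicCompletion K)ˣ) (α : Multiset ℂ),
                    HasSatakeParameterAt P.1 (principalCongruenceLevel 2 K 𝔫) v ϖ α ∧
                    (α.map fun z => (X : ℂ[X]) -
                        Polynomial.C (((Real.sqrt (v.residueCard : ℝ) : ℝ) : ℂ) * z)).prod =
                      (frobPoly ((W.baseChange K).frobeniusTraceAt v) v.residueCard).map
                        (Int.castRingHom ℂ)) ∧
            (∃ (hK : isCompact_glFiniteIntegralLevel 2 K)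
                (π πH πV : CuspidalAutomorphicRepData 2 K hK),
                π.1.HasWeightZero ∧ πH.1.IsLAlgebraic ∧ πV.1.IsLAlgebraic ∧
                ∀ᶠ v : HeightOneSpectrum (𝓞 K) in cofinite, ∃ (α β γ : Multiset ℂ),
                  (π.1.HasSatakeParamAt v α ∧
                    (α.map fun z => (X : ℂ[X]) -
                        Polynomial.C (((Real.sqrt (v.residueCard : ℝ) : ℝ) : ℂ) * z)).prod =
                      (frobPoly ((W.baseChange K).frobeniusTraceAt v) v.residueCard).map
                        (Int.castRingHom ℂ)) ∧
                  (πH.1.HasSatakeParamAt v β ∧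
                    (β.map fun z => (X : ℂ[X]) - Polynomial.C z).prod =
                      (frobPoly ((W.baseChange K).frobeniusTraceAt v) v.residueCard).map
                        (Int.castRingHom ℂ)) ∧
                  (πV.1.HasSatakeParamAt v γ ∧
                    (γ.map fun z => (X : ℂ[X]) - Polynomial.C z⁻¹).prod =
                      (frobPoly ((W.baseChange K).frobeniusTraceAt v) v.residueCard).map
                        (Int.castRingHom ℂ))) := by
  refine ⟨fun h F _ _ _ W _ hW => ?_, exists_isCMField_forall_isSolvable_isTateAutomorphic_of_satake⟩
  obtain ⟨F', hF', hNF', hAlg, hCM, hGal, hsol⟩ := h W hW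
  refine ⟨F', hF', hNF', hAlg, hCM, hGal, fun K _ _ _ _ _ hs => ?_⟩
  obtain ⟨hL2, hcusp⟩ := hsol K hs
  haveI : (W.baseChange K).IsElliptic := by
    dsimp only [WeierstrassCurve.baseChange]
    infer_instance
  exact ⟨hL2.exists_satake, hcusp.exists_satake⟩

end Reduction

/-! ### Input 3, field theory: the intermediate fields of the strong form are CM

The printed Prop. 6.5.13 (2) is applied, in the strong form, over every intermediate field
`F ⊆ K ⊆ F'` with `Gal(F'/K)` soluble, and its hypotheses require `K` to be imaginary CM (or
totally real). This is automatic: complex conjugation `c` of the CM field `F'` commutes with every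
automorphism of `F'` (it induces complex conjugation under every complex embedding), so for `F'/K`
Galois `c` maps `K` into the fixed field of `Gal(F'/K)`, i.e. into `K`; the restriction is a
`ℚ`-automorphism of `K` inducing complex conjugation under every embedding of `K` (every embedding
extends to `F'`), whence `K` is totally real or CM
(`NumberFields.isTotallyReal_or_isCMField_of_forall_isConj`), and it is not totally real because it
contains the totally complex `F`. -/

section CMTower

open NumberField.ComplexEmbedding
open scoped ComplexConjugate

/-- Complex conjugation of a CM number field commutes with every ring automorphism `g`:
`g (c x) = c (g x)` — both sides have the same image `\overline{φ (g x)}` under any complex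
embedding `φ` (`φ ∘ g` is again an embedding; Mathlib `IsCMField.complexEmbedding_complexConj`).
Shimura, *Abelian Varieties with Complex Multiplication and Modular Functions* (1998), §18.2,
Lemma 18.2 (i) and the remark following its proof (the conjugation `β` of a Galois CM field
"belongs to the center"). [cite: Shimura1998, §18.2, Lemma 18.2 (i) and the following remark] -/
theorem ringEquiv_apply_complexConj {L : Type*} [Field L] [NumberField L] [IsCMField L]
    (g : L ≃+* L) (x : L) :
    g (IsCMField.complexConj L x) = IsCMField.complexConj L (g x) := by
  obtain ⟨φ⟩ : Nonempty (L →+* ℂ) := inferInstance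
  apply φ.injective
  have h1 := IsCMField.complexEmbedding_complexConj L (φ.comp g.toRingHom) x
  rw [RingHom.comp_apply, RingHom.comp_apply] at h1
  rw [IsCMField.complexEmbedding_complexConj L φ (g x)]
  exact h1

/-- For a Galois extension of number fields `F'/K` with `F'` CM, complex conjugation of `F'`
preserves `K`: `c (algebraMap K F' x)` is fixed by `Gal(F'/K)` (`ringEquiv_apply_complexConj`),
hence lies in `K` (Mathlib `IsGalois.mem_bot_iff_fixed`). [folklore] -/
theorem exists_algebraMap_eq_complexConj_algebraMap {K F' : Type*} [Field K] [NumberField K]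
    [Field F'] [NumberField F'] [IsCMField F'] [Algebra K F'] [IsGalois K F'] (x : K) :
    ∃ y : K, algebraMap K F' y = IsCMField.complexConj F' (algebraMap K F' x) := by
  haveI : FiniteDimensional K F' := Module.Finite.of_restrictScalars_finite ℚ K F'
  have hfix : ∀ f : F' ≃ₐ[K] F',
      f (IsCMField.complexConj F' (algebraMap K F' x)) =
        IsCMField.complexConj F' (algebraMap K F' x) := fun f => by
    rw [show f (IsCMField.complexConj F' (algebraMap K F' x)) =
        (f : F' ≃+* F') (IsCMField.complexConj F' (algebraMap K F' x)) from rfl,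
      ringEquiv_apply_complexConj, AlgEquiv.coe_ringEquiv, AlgEquiv.commutes]
  obtain ⟨y, hy⟩ := IntermediateField.mem_bot.mp ((IsGalois.mem_bot_iff_fixed _).mpr hfix)
  exact ⟨y, hy⟩

-- TODO(general form): Lemma 18.2 (iv) for an arbitrary subfield of a CM field (via the Galois
-- closure, Lemma 18.2 (iii)); the Galois case below is what the soluble descent uses.
/-- **A totally complex number field admitting a CM Galois extension is CM.** If `F'/K` is a
Galois extension of number fields with `F'` CM and `K` totally complex, then `K` is CM: the
restriction `τ` of the complex conjugation of `F'` to `K`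
(`exists_algebraMap_eq_complexConj_algebraMap`) is a `ℚ`-automorphism of `K` inducing complex
conjugation under every complex embedding of `K` (extend the embedding to `F'`,
`IsAlgClosed.lift`), so `K` is totally real or CM
(`NumberFields.isTotallyReal_or_isCMField_of_forall_isConj`), and a totally complex field is not
totally real. (In particular every intermediate field of a Galois extension of CM fields
`F'/F` is CM: `isCMField_of_isScalarTower`.) This is the Galois case of Shimura, *Abelian
Varieties with Complex Multiplication and Modular Functions* (1998), §18.2, Lemma 18.2 (iv): *"A
subfield of a CM-field is either totally real or a CM-field"* (the general case goes through the
Galois closure, Lemma 18.2 (iii)).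
[cite: Shimura1998, §18.2, Lemma 18.2 (iv) (Galois case)] -/
theorem isCMField_of_isGalois_isCMField (K F' : Type*) [Field K] [NumberField K]
    [IsTotallyComplex K] [Field F'] [NumberField F'] [IsCMField F'] [Algebra K F']
    [IsGalois K F'] : IsCMField K := by
  haveI : FiniteDimensional K F' := Module.Finite.of_restrictScalars_finite ℚ K F'
  -- the restriction `τ` of complex conjugation to `K`, as a function
  choose τ hτ using fun x : K => exists_algebraMap_eq_complexConj_algebraMap (F' := F') x
  have hinj : Function.Injective (algebraMap K F') := (algebraMap K F').injective
  have hττ : ∀ x, τ (τ x) = x := fun x => hinj (by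
    rw [hτ, hτ, IsCMField.complexConj_apply_apply])
  have hmul : ∀ x y, τ (x * y) = τ x * τ y := fun x y => hinj (by
    rw [map_mul, hτ, hτ, hτ, map_mul, map_mul])
  have hadd : ∀ x y, τ (x + y) = τ x + τ y := fun x y => hinj (by
    rw [map_add, hτ, hτ, hτ, map_add, map_add])
  let e : K ≃+* K :=
    { toFun := τ, invFun := τ, left_inv := hττ, right_inv := hττ, map_mul' := hmul,
      map_add' := hadd }
  have hrat : ∀ q : ℚ, e (algebraMap ℚ K q) = algebraMap ℚ K q := fun q => by
    rw [eq_ratCast, map_ratCast]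
  let σ : K ≃ₐ[ℚ] K := { e with commutes' := hrat }
  have hσ : ∀ x, algebraMap K F' (σ x) = IsCMField.complexConj F' (algebraMap K F' x) := hτ
  -- `σ` induces complex conjugation under every embedding `φ : K → ℂ`
  have hconj : ∀ φ : K →+* ℂ, IsConj φ σ := fun φ => by
    letI : Algebra K ℂ := φ.toAlgebra
    let ι : F' →ₐ[K] ℂ := IsAlgClosed.lift
    have hι : ∀ x : K, ι (algebraMap K F' x) = φ x := fun x => ι.commutes x
    refine RingHom.ext fun x => ?_
    change conj (φ x) = φ (σ x)
    rw [← hι, ← hι, hσ]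
    exact (IsCMField.complexEmbedding_complexConj F' (ι : F' →+* ℂ) (algebraMap K F' x)).symm
  rcases NumberFields.isTotallyReal_or_isCMField_of_forall_isConj σ hconj with hTR | hCM
  · exfalso
    obtain ⟨φ⟩ : Nonempty (K →+* ℂ) := inferInstance
    haveI := hTR
    exact IsTotallyComplex.complexEmbedding_not_isReal φ
      (IsTotallyReal.complexEmbedding_isReal φ)
  · exact hCM

/-- **Intermediate fields of a Galois extension of CM fields are CM** (the fields `K` of the
strong form `exists_isCMField_forall_isSolvable_isTateAutomorphic`, to which Prop. 6.5.13 (2) is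
applied): if `F` is CM (indeed totally complex suffices), `F'/F` is Galois with `F'` CM, and
`F ⊆ K ⊆ F'` (`IsScalarTower F K F'`), then `K` is CM — `K` is totally complex as it contains `F`
(Mathlib `isTotallyComplex_of_algebra`), `F'/K` is Galois (Mathlib `IsGalois.tower_top_of_isGalois`),
and `isCMField_of_isGalois_isCMField` applies.
[cite: Shimura1998, §18.2, Lemma 18.2 (iv) (Galois case)]
[cite: AllenCalegariCaraianiGeeEtAl2023, Prop. 6.5.13 (2) (hypothesis "E is also imaginary CM")] -/
theorem isCMField_of_isScalarTower (F K F' : Type*) [Field F] [NumberField F] [IsCMField F]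
    [Field K] [NumberField K] [Field F'] [NumberField F'] [IsCMField F'] [Algebra F K]
    [Algebra F F'] [Algebra K F'] [IsScalarTower F K F'] [IsGalois F F'] : IsCMField K := by
  haveI : IsTotallyComplex K := isTotallyComplex_of_algebra F K
  haveI : IsGalois K F' := IsGalois.tower_top_of_isGalois F K F'
  exact isCMField_of_isGalois_isCMField K F'

end CMTower

end Literature.NumberTheory.Automorphic
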